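import Literature.NumberTheory.Sieve.HeathBrownCubicLemma92
import Literature.NumberTheory.Sieve.HeathBrownCubicGrossenSiegel
import HarnessLib

/-!
# Heath-Brown's Lemma 3.8 holds (discharge of `HeathBrown2001_lemma_3_8`)

D. R. Heath-Brown, *Primes represented by `x³ + 2y³`*, Acta Math. 186 (2001), 1–84, Lemma 3.8 (pp. 18–19,
proved in §§8–9, pp. 47–60; = G. Harman, *Prime-Detecting Sieves*, Lemma 13.6): the Siegel–Walfisz property
(3.14) of the weights `f = d − e` in cubes `𝒞` of side `S₀ ≥ L²`, uniformly for `q ≤ (log X)^A`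
("the implied constant is ineffective", p. 19).

The named fact `HeathBrown2001_lemma_3_8` of `HeathBrownCubicTypeII` is discharged here by composing the two
halves of its proof that the tree already holds as theorems:

* `HeathBrown2001_lemma_3_8_of_lemma94` (`HeathBrownCubicLemma92`): Lemma 3.8 from Lemma 9.4 alone — p. 52,
  "A comparison of Lemmas 8.1, 9.1 and 9.2 immediately yields Lemma 3.8", with Lemma 8.1
  (`HeathBrown2001_lemma_8_1`), Lemma 9.1 (`HeathBrown2001_lemma_9_1`) and Lemma 9.2 ⇐ Lemma 9.4
  (`HeathBrown2001_lemma_9_2_of_lemma94`: characters `mod q`, the Grössencharaktere `ν^{(j,k)}`, Lemma 9.3,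
  Lemma 9.5, Lemma 4.10 and the integration over the cube, pp. 52–60) all proved;
* `grossenCharPNT_holds` (`HeathBrownCubicGrossenSiegel`): Lemma 9.4 itself — T. Mitsui's prime number theorem
  with Grössencharakteren for `K = ℚ(∛2)`, uniform in `q ≤ (log z)^A`, `|j|, |k| ≤ exp(c√(log z))`, in the
  form `∀ A > 0, ∃ c > 0, C, z₀, GrossenCharPNT A c C z₀` (`HeathBrownCubicGrossenPrimeSums`), proved in the
  tree from the zero-free region with conductor and Siegel's theorem for the real ray class characters of `K`
  (ineffective, exactly as remarked on p. 55 of the paper).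

Pure-proof file (no definitions, no named facts); a separate sibling because `HeathBrownCubicTypeII` is
imported by both chains.

## References

* D. R. Heath-Brown, *Primes represented by `x³ + 2y³`*, Acta Math. 186 (2001), 1–84: Lemma 3.8 (pp. 18–19),
  Lemma 8.1 (p. 47), Lemmas 9.1–9.2 (p. 52), Lemma 9.4 (p. 55). [cite: HeathBrownActa2001, Lemma 3.8]
* T. Mitsui, *Generalized prime number theorem*, Jap. J. Math. 26 (1956), 1–42, Lemma 5. [cite: Mitsui1956, Lemma 5]
* G. Harman, *Prime-Detecting Sieves*, LMS Monographs 33, Princeton 2007, Lemma 13.6 and §13.6.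
  [cite: Harman2007, Lemma 13.6]

## Tree search

`lean search 'HeathBrown2001_lemma_3_8_holds' --decl` (2026-08-15): no hit before this file. Used:
`HeathBrown2001_lemma_3_8_of_lemma94` (`HeathBrownCubicLemma92`), `grossenCharPNT_holds`
(`HeathBrownCubicGrossenSiegel`).
-/

noncomputable section

namespace Literature.NumberTheory.Sieve.CubicSieve

/-- **Heath-Brown's Lemma 3.8 holds** (the named fact `HeathBrown2001_lemma_3_8` of `HeathBrownCubicTypeII`,
discharged): Lemma 3.8 ⇐ Lemma 9.4 (`HeathBrown2001_lemma_3_8_of_lemma94`, through Lemmas 8.1, 9.1, 9.2) and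
Lemma 9.4 = Mitsui's prime number theorem with Grössencharakteren (`grossenCharPNT_holds`). The constant is
ineffective (Siegel's theorem), as stated on p. 19 of the paper.
[cite: HeathBrownActa2001, Lemma 3.8] [cite: Harman2007, Lemma 13.6] -/
theorem HeathBrown2001_lemma_3_8_holds : HeathBrown2001_lemma_3_8 :=
  HeathBrown2001_lemma_3_8_of_lemma94 grossenCharPNT_holds

end Literature.NumberTheory.Sieve.CubicSieve
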